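import Summits.HodgeConjecture.HodgeConjecture.Theorems.Ring2AbelianAllWeilSignature
import Summits.HodgeConjecture.HodgeConjecture.Theorems.Ring2HypothesesWeilDiscriminantHolds
import Literature.AlgebraicGeometry.VanGeemen1994.WeilDiscriminantOfHyperbolic
import HarnessLib

/-!
# Ring 2 · AbelianAll (ab-weil-1, gen 7, part 4/4) — the WRONG-SIGN components `(n, d, δ)`,
  `sign δ ≠ (-1)ⁿ`, hold outright

research route, not a corollary; conditional on HC_CM plus one named minimal statement.
Cell line: research route conditional on HC_CM; not a corollary; Q11.4-sentence-2 already refuted in dim ≥ 3.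
`HC_CM` (`Theses.RankFourFaces.CMAbelianHodge`) does not occur in this file, and no open case of the
Hodge conjecture is claimed. The one geometric input is part 3 (`weilSign_eq_of_hasWeilDiscriminantNondeg`: van Geemen's
Lemma 5.2 (4) on the carriers, from Hodge–Riemann in degree one) together with the tree's
Deligne–Milne 4.4 ⇒ (`isWeilType_of_weilClass_ne_zero`).

## What is proved (0 sorry)

* `weilClassesComponent_of_weilSign_ne` — **every typed component `Ring2.Hypotheses.WeilClassesComponent
  n d δ` with `sign δ ≠ (-1)ⁿ` (`n, d ≥ 1`) holds**: a member `(A, φ, e, a)` with a non-degenerate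
  `det H` of class `δ` carrying a non-zero rational `(n,n)` Weil class is of Weil type, so
  `sign δ = (-1)ⁿ` — there is no such member, and the zero class is algebraic. Van Geemen 4.14 / 5.4:
  "abelian varieties of Weil type with `det H = x`" form a family only for `(-1)ⁿ x > 0`; the tree's
  component docstring: "for `(-1)ⁿ·δ < 0` the component is vacuously true in print".
* parity forms `weilClassesComponent_of_even_of_weilSign_eq_neg_one`, `…_of_odd_of_weilSign_eq_one`;
  CLOSED CELLS for every `d ≥ 1`: `weilClassesComponent_two_mk_of_neg` (`(2, d, [q])`, `q < 0`),
  `weilClassesComponent_two_neg_one` (`(2, d, [-1])`), `weilClassesComponent_three_mk_of_pos`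
  (`(3, d, [q])`, `q > 0`), `weilClassesComponent_three_one` (`(3, d, [1])`).
* `forall_weilClassesComponent_iff_sign`, `weilClassesByComponent_iff_sign`,
  `weilFourfoldResidual_iff_sign`, `weilFourfoldResidualSq_iff_sign`, `forall_nonsplit_three_iff_sign` — the
  component targets, `WeilClassesByComponent`, the Weil-fourfold residuals (gen 1 / gen 4) and the non-split
  sixfold half are each equivalent to their restriction to the classes of sign `(-1)ⁿ`. For the atlas: in
  every row `g = 2n` the `δ`-column is HALVED — the wrong-sign cells are closed in the tree,
  unconditionally and for every `d ≥ 1`; the open fourfold residual is `{(2, d, δ) : δ > 0, δ ≠ [1]}`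
  (`d ∉ {1, 3}`; squarefree `d` by gen 6), the open non-split sixfold half is `{(3, d, δ) : δ < 0, δ ≠ [-1]}`.
* NO EXISTENCE BINDER (van Geemen 5.2 (1)–(2) on the carriers is the literature seat's
  `VanGeemen1994.exists_hasWeilDiscriminantNondeg`; the typed node is typer2's
  `Ring2.Hypotheses.polarizedWeilDiscriminantExists_holds`, part XXIX): `exists_hasWeilDiscriminantNondeg_weilSign`
  (a Weil-type `(A, φ, h_K)` HAS a non-degenerate class, of sign `(-1)ⁿ`); `weilClassesImaginaryQuadratic_of_sign_components`
  (rung R∞ from the right-sign cells, no binder); `weilSixfolds_iff_negative_components` (`W₆ ↔` the negative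
  sixfold cells, no binder); `nonsplitSixfolds_of_negative_nonsplit_components_of_converse` (rung R1′ from the
  NEGATIVE non-split sixfold cells granted only the converse half of Landherr, `LandherrHyperbolicOfSplitDiscriminant`)
  and `nonsplitSixfolds_of_negative_nonsplit_components` (same granted the `↔`-node `LandherrSplitCriterion`).

What is NOT proved: Landherr's converse (`det H = (-1)ⁿ ⇒` hyperbolic, (5.4.1) ⇐), any right-sign component
beyond those already in the tree.

## References

* [vanGeemen1994HodgeAV] B. van Geemen, An introduction to the Hodge conjecture for abelian varieties,
  LNM 1594 (1994), 4.9, 4.14, Lemma 5.2 (1)–(4), (5.4.1).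
* [Markman2025SecantWeil] E. Markman, arXiv:2502.03415 (preprint, unrefereed), §1.1 (the discriminant
  invariant `det H ∈ ℚ^×/Nm(K^×)`).
* [VoisinHodgeI2002] C. Voisin, Hodge Theory and Complex Algebraic Geometry I, Thm. 6.32, §7.1.2.
* [Deligne1982HodgeCycles] P. Deligne, Hodge cycles on abelian varieties, LNM 900, proof of Thm. 4.8.
-/

noncomputable section

set_option linter.dupNamespace false

open CategoryTheory Polynomial
open Literature.AlgebraicGeometry Literature.AlgebraicGeometry.Motives
open Literature.AlgebraicGeometry.HodgeTheory
open Literature.AlgebraicGeometry.VanGeemen1994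
open Literature.AlgebraicTopology.SingularHomology
open Summit.HodgeConjecture.HodgeConjecture.WeilTypeLadder
open Summit.HodgeConjecture.HodgeConjecture.Ring2.Hypotheses

namespace Summit.HodgeConjecture.HodgeConjecture.Ring2.AbelianAll

/-! ### §4 The wrong-sign components `(n, d, δ)`, `sign δ ≠ (-1)ⁿ`, hold outright -/

/-- **Every typed Weil component of the WRONG SIGN holds** (`n, d ≥ 1`, `sign δ ≠ (-1)ⁿ`): a member
`(A, φ, e, a)` with `det H = δ` non-degenerate that carries a non-zero rational `(n,n)` Weil class is of
Weil type (Deligne–Milne 4.4 ⇒, `isWeilType_of_weilClass_ne_zero`), so `sign δ = (-1)ⁿ` by Lemma 5.2 (4)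
— there is no such member, and the zero class is algebraic. Van Geemen 4.14 / 5.4: the Weil locus has
components only for `(-1)ⁿ x > 0`. [cite: vanGeemen1994HodgeAV, 4.14, Lemma 5.2 (4) and 5.4]
[cite: Deligne1982HodgeCycles, §4 Prop. 4.4] -/
theorem weilClassesComponent_of_weilSign_ne {n d : ℕ} (hn : 0 < n) (hd : 0 < d) {δ : weilNormResidueGroup d}
    (hδ : weilSign d δ ≠ (-1) ^ n) : WeilClassesComponent n d δ := by
  intro A φ hA _hX hφ e a haQ ha0 hdisc c _hcQ hcH hw
  by_cases hc0 : c = 0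
  · rw [hc0]; exact Submodule.zero_mem _
  exact absurd (weilSign_eq_of_hasWeilDiscriminantNondeg (isWeilType_of_weilClass_ne_zero hn hd hA hφ hw hc0 hcH)
    e haQ ha0 hdisc) hδ

/-- **Even `n`: every component `(n, d, δ)` with `δ < 0` holds** (`n, d ≥ 1`). [cite: vanGeemen1994HodgeAV, Lemma 5.2 (4)] -/
theorem weilClassesComponent_of_even_of_weilSign_eq_neg_one {n d : ℕ} (hn : Even n) (hn0 : 0 < n) (hd : 0 < d)
    {δ : weilNormResidueGroup d} (hδ : weilSign d δ = -1) : WeilClassesComponent n d δ :=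
  weilClassesComponent_of_weilSign_ne hn0 hd fun h => absurd (hδ.symm.trans (h.trans hn.neg_one_pow)) (by decide)

/-- **Odd `n`: every component `(n, d, δ)` with `δ > 0` holds** (`d ≥ 1`). [cite: vanGeemen1994HodgeAV, Lemma 5.2 (4)] -/
theorem weilClassesComponent_of_odd_of_weilSign_eq_one {n d : ℕ} (hn : Odd n) (hd : 0 < d)
    {δ : weilNormResidueGroup d} (hδ : weilSign d δ = 1) : WeilClassesComponent n d δ :=
  weilClassesComponent_of_weilSign_ne hn.pos hd fun h => absurd (hδ.symm.trans (h.trans hn.neg_one_pow)) (by decide)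

/-- **Fourfolds: every component `(2, d, δ)` with `δ < 0` holds** (`d ≥ 1`): in dimension four the Weil
locus has components only for `det H > 0`. [cite: vanGeemen1994HodgeAV, Lemma 5.2 (4) and 5.4] -/
theorem weilClassesComponent_two_of_weilSign_eq_neg_one {d : ℕ} (hd : 0 < d) {δ : weilNormResidueGroup d}
    (hδ : weilSign d δ = -1) : WeilClassesComponent 2 d δ :=
  weilClassesComponent_of_even_of_weilSign_eq_neg_one even_two (by norm_num) hd hδ

/-- **Sixfolds: every component `(3, d, δ)` with `δ > 0` holds** (`d ≥ 1`): in dimension six the Weil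
locus has components only for `det H < 0`. [cite: vanGeemen1994HodgeAV, Lemma 5.2 (4) and 5.4] -/
theorem weilClassesComponent_three_of_weilSign_eq_one {d : ℕ} (hd : 0 < d) {δ : weilNormResidueGroup d}
    (hδ : weilSign d δ = 1) : WeilClassesComponent 3 d δ :=
  weilClassesComponent_of_odd_of_weilSign_eq_one (by decide) hd hδ

/-- `sign [q] = 1` for `q > 0`. [folklore] -/
theorem weilSign_mk_of_pos (d : ℕ) {q : ℚˣ} (hq : 0 < (q : ℚ)) :
    weilSign d (QuotientGroup.mk q : weilNormResidueGroup d) = 1 := by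
  rw [weilSign_mk, ratSign_eq_one_iff]; exact hq

/-- `sign [q] = -1` for `q < 0`. [folklore] -/
theorem weilSign_mk_of_neg (d : ℕ) {q : ℚˣ} (hq : (q : ℚ) < 0) :
    weilSign d (QuotientGroup.mk q : weilNormResidueGroup d) = -1 := by
  rw [weilSign_mk, ratSign_eq_neg_one_iff]; exact hq

/-- **Closed cells, fourfolds: `(2, d, [q])` for every `q < 0` and every `d ≥ 1`.**
[cite: vanGeemen1994HodgeAV, Lemma 5.2 (4) and 5.4] -/
theorem weilClassesComponent_two_mk_of_neg {d : ℕ} (hd : 0 < d) {q : ℚˣ} (hq : (q : ℚ) < 0) :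
    WeilClassesComponent 2 d (QuotientGroup.mk q) :=
  weilClassesComponent_two_of_weilSign_eq_neg_one hd (weilSign_mk_of_neg d hq)

/-- **Closed cell, fourfolds: `(2, d, [-1])` for every `d ≥ 1`** (for `d = 1`: `-1 ∉ Nm(ℚ(i)^×)·ℚ_{>0}`
is the class of the negative rationals). [cite: vanGeemen1994HodgeAV, Lemma 5.2 (4) and 5.4] -/
theorem weilClassesComponent_two_neg_one {d : ℕ} (hd : 0 < d) :
    WeilClassesComponent 2 d (QuotientGroup.mk (-1 : ℚˣ)) :=
  weilClassesComponent_two_mk_of_neg hd (by rw [Units.val_neg, Units.val_one]; norm_num)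

/-- **Closed cells, sixfolds: `(3, d, [q])` for every `q > 0` and every `d ≥ 1`.**
[cite: vanGeemen1994HodgeAV, Lemma 5.2 (4) and 5.4] -/
theorem weilClassesComponent_three_mk_of_pos {d : ℕ} (hd : 0 < d) {q : ℚˣ} (hq : 0 < (q : ℚ)) :
    WeilClassesComponent 3 d (QuotientGroup.mk q) :=
  weilClassesComponent_three_of_weilSign_eq_one hd (weilSign_mk_of_pos d hq)

/-- **Closed cell, sixfolds: the trivial class `(3, d, [1])` for every `d ≥ 1`** — no Weil sixfold has
`det H ∈ Nm(K^×)`. [cite: vanGeemen1994HodgeAV, Lemma 5.2 (4) and 5.4] -/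
theorem weilClassesComponent_three_one {d : ℕ} (hd : 0 < d) : WeilClassesComponent 3 d 1 :=
  weilClassesComponent_three_of_weilSign_eq_one hd (map_one _)

/-- **The `δ`-column of every row `g = 2n` is halved**: the component targets of `(n, d)` (`n, d ≥ 1`) are
equivalent to their restriction to the classes of sign `(-1)ⁿ`. [cite: vanGeemen1994HodgeAV, 4.14 and Lemma 5.2 (4)] -/
theorem forall_weilClassesComponent_iff_sign {n d : ℕ} (hn : 0 < n) (hd : 0 < d) :
    (∀ δ : weilNormResidueGroup d, WeilClassesComponent n d δ) ↔
      ∀ δ : weilNormResidueGroup d, weilSign d δ = (-1) ^ n → WeilClassesComponent n d δ := by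
  refine ⟨fun h δ _ => h δ, fun h δ => ?_⟩
  by_cases hs : weilSign d δ = (-1) ^ n
  · exact h δ hs
  · exact weilClassesComponent_of_weilSign_ne hn hd hs

/-- **`WeilClassesByComponent` restricted to the right sign.** [cite: vanGeemen1994HodgeAV, 4.14 and Lemma 5.2 (4)] -/
theorem weilClassesByComponent_iff_sign :
    WeilClassesByComponent ↔ ∀ n : ℕ, 2 ≤ n → ∀ d : ℕ, 0 < d → ∀ δ : weilNormResidueGroup d,
      weilSign d δ = (-1) ^ n → WeilClassesComponent n d δ := by
  refine ⟨fun h n hn d hd δ _ => h n hn d hd δ, fun h n hn d hd => ?_⟩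
  exact (forall_weilClassesComponent_iff_sign (by omega) hd).2 (h n hn d hd)

/-- **The Weil-fourfold residual restricted to the right sign**: only the non-split classes `δ > 0`,
`δ ≠ [1]`, remain (`d ∉ {1, 3}`). [cite: vanGeemen1994HodgeAV, 4.14 and Lemma 5.2 (4)]
[cite: Markman2025SecantWeil, Cor. 1.6.1 (preprint, unrefereed)] -/
theorem weilFourfoldResidual_iff_sign :
    WeilFourfoldResidual ↔ ∀ d : ℕ, 0 < d → d ≠ 1 → d ≠ 3 → ∀ δ : weilNormResidueGroup d,
      δ ≠ splitDiscriminantClass 2 d → weilSign d δ = 1 → WeilClassesComponent 2 d δ := by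
  refine ⟨fun h d hd h1 h3 δ hδ _ => h d hd h1 h3 δ hδ, fun h d hd h1 h3 δ hδ => ?_⟩
  by_cases hs : weilSign d δ = 1
  · exact h d hd h1 h3 δ hδ hs
  · exact weilClassesComponent_two_of_weilSign_eq_neg_one hd ((weilSign_eq_one_or d δ).resolve_left hs)

/-- **The squarefree Weil-fourfold residual restricted to the right sign.** [cite: vanGeemen1994HodgeAV, 4.14 and Lemma 5.2 (4)]
[cite: Markman2025SecantWeil, Cor. 1.6.1 (preprint, unrefereed)] -/
theorem weilFourfoldResidualSq_iff_sign :
    WeilFourfoldResidualSq ↔ ∀ d : ℕ, 0 < d → Squarefree d → d ≠ 1 → d ≠ 3 → ∀ δ : weilNormResidueGroup d,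
      δ ≠ splitDiscriminantClass 2 d → weilSign d δ = 1 → WeilClassesComponent 2 d δ := by
  refine ⟨fun h d hd hsq h1 h3 δ hδ _ => h d hd hsq h1 h3 δ hδ, fun h d hd hsq h1 h3 δ hδ => ?_⟩
  by_cases hs : weilSign d δ = 1
  · exact h d hd hsq h1 h3 δ hδ hs
  · exact weilClassesComponent_two_of_weilSign_eq_neg_one hd ((weilSign_eq_one_or d δ).resolve_left hs)

/-- **The non-split sixfold components restricted to the right sign**: the hypothesis of W4
(`nonsplitSixfolds_of_nonsplit_components`) — every `(3, d, δ ≠ [-1])` — is equivalent to its restriction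
to `δ < 0`. [cite: vanGeemen1994HodgeAV, 4.14, Lemma 5.2 (4) and (5.4.1)] -/
theorem forall_nonsplit_three_iff_sign :
    (∀ d : ℕ, 0 < d → ∀ δ : weilNormResidueGroup d, δ ≠ splitDiscriminantClass 3 d → WeilClassesComponent 3 d δ) ↔
      ∀ d : ℕ, 0 < d → ∀ δ : weilNormResidueGroup d, δ ≠ splitDiscriminantClass 3 d → weilSign d δ = -1 →
        WeilClassesComponent 3 d δ := by
  refine ⟨fun h d hd δ hδ _ => h d hd δ hδ, fun h d hd δ hδ => ?_⟩
  by_cases hs : weilSign d δ = -1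
  · exact h d hd δ hδ hs
  · exact weilClassesComponent_three_of_weilSign_eq_one hd ((weilSign_eq_one_or d δ).resolve_right hs)

/-! ### §5 No existence binder: Lemma 5.2 (1)–(2) is a Literature theorem, the typed node typer2's part XXIX -/

/-- **A Weil-type `(A, φ, h_K)` has a non-degenerate discriminant class, and its sign is `(-1)ⁿ`** (Lemma 5.2
(1)–(2) from the Literature, (4) from part 3; by the Literature's `hasWeilDiscriminantNondeg_ksymm_unique` the
class is moreover unique). [cite: vanGeemen1994HodgeAV, Lemma 5.2 (1)–(4)] -/
theorem exists_hasWeilDiscriminantNondeg_weilSign {A : AbelianVariety ℂ} {φ : A ⟶ A} {n d : ℕ}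
    (hW : IsWeilType A φ n d) (e : ProjectiveEmbedding A.X) {a : complexBetti (projectiveSpace e.n ℂ) 2}
    (haQ : IsRationalClass a) (ha0 : a ≠ 0) :
    ∃ δ : weilNormResidueGroup d,
      HasWeilDiscriminantNondeg A φ n d
          ((d : ℂ) • complexBetti.map e.ι 2 a + complexBetti.map φ.hom.hom.hom 2 (complexBetti.map e.ι 2 a)) δ ∧
        weilSign d δ = (-1) ^ n := by
  obtain ⟨δ, hδ⟩ := exists_hasWeilDiscriminantNondeg hW.pos hW.dim_eq hW.d_pos hW.sq_eq e haQ ha0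
  exact ⟨δ, hδ, weilSign_eq_of_hasWeilDiscriminantNondeg hW e haQ ha0 hδ⟩

/-- **Rung R∞ (`WeilClassesImaginaryQuadratic`) from the RIGHT-SIGN components alone, no binder** (typer2's
W3 `weilClassesImaginaryQuadratic_of_byComponent_holds`, composed with §4). [cite: vanGeemen1994HodgeAV, 4.14 and Lemma 5.2] -/
theorem weilClassesImaginaryQuadratic_of_sign_components
    (h : ∀ n : ℕ, 2 ≤ n → ∀ d : ℕ, 0 < d → ∀ δ : weilNormResidueGroup d, weilSign d δ = (-1) ^ n →
      WeilClassesComponent n d δ) :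
    WeilClassesImaginaryQuadratic :=
  weilClassesImaginaryQuadratic_of_byComponent_holds (weilClassesByComponent_iff_sign.2 h)

/-- **`W₆` (`Theses.SevenfoldWeilCensus.WeilSixfolds`: all Weil classes on all Weil-type sixfolds over imaginary
quadratic fields) `↔` the NEGATIVE sixfold components `(3, d, δ < 0)`, no binder** (typer2's fact-free
`weilSixfolds_iff_components`, composed with §4). [cite: vanGeemen1994HodgeAV, 4.14 and Lemma 5.2 (4)] -/
theorem weilSixfolds_iff_negative_components :
    Theses.SevenfoldWeilCensus.WeilSixfolds ↔
      ∀ d : ℕ, 0 < d → ∀ δ : weilNormResidueGroup d, weilSign d δ = -1 → WeilClassesComponent 3 d δ := by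
  refine weilSixfolds_iff_components.trans ⟨fun h d hd δ _ => h d hd δ, fun h d hd => ?_⟩
  exact (forall_weilClassesComponent_iff_sign (by norm_num) hd).2 fun δ hs =>
    h d hd δ (hs.trans (by decide : Odd 3).neg_one_pow)

/-- **Rung R1′ `NonsplitSixfolds` from the NEGATIVE non-split sixfold components, granted only the converse half
of Landherr** (`LandherrHyperbolicOfSplitDiscriminant`: `det H = [(-1)ⁿ] ⇒` hyperbolic; the forward half and
Lemma 5.2 (1)–(2) are Literature theorems). [cite: vanGeemen1994HodgeAV, Lemma 5.2 and (5.4.1)]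
[cite: Landherr1936HermitianForms] -/
theorem nonsplitSixfolds_of_negative_nonsplit_components_of_converse (hL' : LandherrHyperbolicOfSplitDiscriminant)
    (h : ∀ d : ℕ, 0 < d → ∀ δ : weilNormResidueGroup d, δ ≠ splitDiscriminantClass 3 d → weilSign d δ = -1 →
      WeilClassesComponent 3 d δ) :
    NonsplitSixfolds :=
  nonsplitSixfolds_of_nonsplit_components_of_converse_holds hL' (forall_nonsplit_three_iff_sign.2 h)

/-- **Rung R1′ `NonsplitSixfolds` from the NEGATIVE non-split sixfold components**, granted the `↔`-node
`LandherrSplitCriterion` (typer2's W4 `nonsplitSixfolds_of_nonsplit_components_holds` composed with §4; no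
existence binder). [cite: vanGeemen1994HodgeAV, Lemma 5.2 and (5.4.1)] -/
theorem nonsplitSixfolds_of_negative_nonsplit_components (hL : LandherrSplitCriterion)
    (h : ∀ d : ℕ, 0 < d → ∀ δ : weilNormResidueGroup d, δ ≠ splitDiscriminantClass 3 d → weilSign d δ = -1 →
      WeilClassesComponent 3 d δ) :
    NonsplitSixfolds :=
  nonsplitSixfolds_of_nonsplit_components_holds hL (forall_nonsplit_three_iff_sign.2 h)

end Summit.HodgeConjecture.HodgeConjecture.Ring2.AbelianAll

end
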